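import Summits.CriticalPhenomena.PercolationContinuityZ3.Theorems.Transplant.FKConnectivityAllQAntipodalMinorWeightGluing
import Summits.CriticalPhenomena.PercolationContinuityZ3.Theorems.Transplant.FKConnectivityAllQAntipodalQfree
import Summits.CriticalPhenomena.PercolationContinuityZ3.Theorems.Transplant.FKConnectivityAllQAntipodalCellAlgebra
import HarnessLib

/-!
# Connectivity correlation inequalities for `φ_{w,q}`, every `q > 0` — file 23e: THEOREM U AT EVERY CLUSTER LEVEL IN EVERY CELL, and
# the `q`-FREE single-edge antipodal inequality in every cell: the Rayleigh difference of a series–parallel graph lies in `(1 − q)·ℝ≥0[z, q]`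

Support file (`--supports stmt-CriticalPhenomena-4575`), FK sub-lane `prim-bschramm-fk-2` (gen 21); builds on p205010 (kernel theorem,
internal audit signed; external expert review pending).  No definitions, no named facts, no sorries; standard axioms.

* **`FK.apUpcCLW_nonneg_of_isTTSP`**: `E` TTSP between `s, t` ⟹ for all `M, C ⊆ E`, every weight `w ≥ 0` and every `h` monotone on the
  subsets of `M`: `0 ≤ apUpcCLW w M C s t h = ∑_{γ ⊆ M} w(k(γ∪C)+k((M\γ)∪C)) (1{s↔t in γ∪C} − 1{s↔t in (M\γ)∪C}) h(γ)` — gen 11's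
  `apUpcC ≥ 0` (geometric weight) and gen 18's `apUpcLW ≥ 0` (no contracted set) at once; corollaries `FK.apUpcC_level_nonneg_of_isTTSP`
  (every coefficient of `q ↦ apUpcC q M C s t h` is `≥ 0`) and `FK.apUpcC_levels_le_nonneg_of_isTTSP`.
* **`FK.apPsiCW_pivot_eq`** — integrating out a pivot edge `x = st` against an arbitrary level weight, with a contracted set:
  `∑_{γ ⊆ M ∪ {x}} w(k(γ∪C)+k(γᶜ∪C)) (1_x γ − 1_x γᶜ)(g(γ∪C) − g(γᶜ∪C)) = − apUpcCLW (n ↦ w(n−1) − w(n)) M C s t (γ ↦ g(γ∪C) − g((M\γ)∪C))`.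
* **`FK.apPsiCW_pivot_sub_nonpos_of_isTTSP`** / **`FK.apPsiC_levels_le_pivot_nonpos_of_isTTSP`**: for every 2-connected series–parallel
  graph `H = E ∪ {st}`, every cell (`M`, `C` ⊆ `H` disjoint: live / contracted, the rest deleted), every pivot `a ∈ M`, every antitone level
  weight (in particular every level cut-off `J`) and every increasing `g` reading neither `a` nor `C`:
  `∑_{γ ⊆ M : k(γ∪C)+k((M\γ)∪C) ≤ J} (1_a γ − 1_a γᶜ)(g(γ∪C) − g((M\γ)∪C)) ≤ 0`.
  READING (FK-Q2 §20/§30): the left side summed against `q^{level}` is `apPsiC q M C 1_a g`, twice the coefficient of `z^{2·1_C + 1_M}` in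
  `Z_H(z)² Cov_{φ_{z,q}}(ω_a, g)`; so the polynomial `Z_H² Cov_{φ_{z,q}}(ω_a, g) ∈ ℝ[z, q]` equals `(q − 1)·P` with `P` having ONLY
  NONNEGATIVE COEFFICIENTS in the edge odds `z` and the cluster weight `q` jointly.  With `g = ω_b` this says: the RAYLEIGH DIFFERENCE
  `ΔZ_H{a,b}(z, q) = Z^{a}_{b} Z^{b}_{a} − Z^{ab} Z_{ab}` of every series–parallel graph is `(1 − q)` times a polynomial with nonnegative
  coefficients in `(z, q)` — one certificate for Wagner's negative correlation at `q < 1`, independence at `q = 1` and positive correlation at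
  `q > 1` (Wagner 2008 / Semple–Welsh 2008 prove `ΔZ ≥ 0` for `z ≥ 0`, `0 < q ≤ 1`, valuewise; false for `K₄`, FK-Q2 §19.6).
* **`FK.apPsiCW_level2_nonpos_of_isTTSP`** (+ partial sums): the same for EVERY increasing `f` reading two live edges.
This is the `|supp f| ≤ 2` case, in every cell, of gen 21's Conjecture C_∞⁺ (`Z_H² Cov_{φ_{z,q}}(f, g) ∈ (q−1)·ℝ≥0[z,q]` for all increasing
`f, g` with disjoint supports on series–parallel graphs; memo FROM-fk-2-g21, FK-Q2 §30); `…AntipodalQfree.lean` has the square-free cells.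
[cite: Grimmett2006, §1.4 eq. (1.20) (p. 15); §3.8 Thm. (3.90) (pp. 61–62); §3.9 (pp. 63–64)] [cite: Wagner2006, Thm. 5.8(d), §5.3]
-/

noncomputable section

namespace Summit.CriticalPhenomena.PercolationContinuityZ3.Theorems

namespace FK

open SimpleGraph Literature.Probability.LatticeModels Literature.Probability.Percolation
open scoped Classical

variable {V : Type*} [Fintype V]

/-! ### Theorem U at every level in every cell -/

section Main

variable {s t : V}

omit [Fintype V] in
/-- A contracted terminal pair kills every term. [folklore] -/
theorem apUpcCLW_eq_zero_of_mem (w : ℕ → ℝ) {E C : Finset (Sym2 V)} (hC : s(s, t) ∈ C) (hst : s ≠ t) (h : Finset (Sym2 V) → ℝ) :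
    apUpcCLW w E C s t h = 0 := by
  unfold apUpcCLW
  refine Finset.sum_eq_zero fun γ _ => ?_
  have key : ∀ A : Finset (Sym2 V), apConn (A ∪ C) s t = 1 := fun A =>
    apConn_of_reachable (Adj.reachable ((fromEdgeSet_adj _).2 ⟨by
      rw [Finset.coe_union]; exact Or.inr (Finset.mem_coe.2 hC), hst⟩))
  rw [key, key, sub_self, zero_mul, mul_zero]

/-- **THEOREM (Theorem U for every nonnegative level weight, in every cell).**  If `E` is a two-terminal series–parallel network between
`s` and `t`, then for all `M, C ⊆ E`, every `w : ℕ → ℝ` with `w ≥ 0` and every `h` monotone on the subsets of `M`: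
`0 ≤ apUpcCLW w M C s t h`.  (The induction of `…AntipodalMinorUpc.lean` with the shifted weights of `…AntipodalWeightUpc.lean`.)
[cite: Grimmett2006, §3.8 Thm. (3.90) (pp. 61–62); §3.9 (pp. 63–64)] [cite: Wagner2006, Thm. 5.8(d), §5.3] -/
theorem apUpcCLW_nonneg_of_isTTSP {E : Finset (Sym2 V)} {s t : V} (hE : IsTTSP E s t) :
    ∀ M C : Finset (Sym2 V), M ⊆ E → C ⊆ E → ∀ w : ℕ → ℝ, (∀ n, 0 ≤ w n) → ∀ h : Finset (Sym2 V) → ℝ,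
      (∀ ⦃A B : Finset (Sym2 V)⦄, A ⊆ B → B ⊆ M → h A ≤ h B) → 0 ≤ apUpcCLW w M C s t h := by
  induction hE with
  | @edge s t hst =>
    intro M C hM hC w hw h hmono
    rcases Finset.subset_singleton_iff.1 hC with rfl | rfl
    · rw [apUpcCLW_empty_right]
      rcases Finset.subset_singleton_iff.1 hM with rfl | rfl
      · rw [apUpcLW_empty]
      · exact apUpcLW_edge hw hst (hmono (Finset.empty_subset _) le_rfl)
    · rw [apUpcCLW_eq_zero_of_mem w (Finset.mem_singleton_self _) hst]
  | @series E₁ E₂ a m b h₁ h₂ hd hV ha hb ih₁ ih₂ =>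
    intro M C hM hC w hw h hmono
    have g₁ : ∀ e ∈ (↑E₁ : Set (Sym2 V)), ∀ z ∈ e, z ∈ {z : V | ∃ e ∈ E₁, z ∈ e} := fun e he z hz => ⟨e, he, hz⟩
    have g₂ : ∀ e ∈ (↑E₂ : Set (Sym2 V)), ∀ z ∈ e, z ∈ {z : V | ∃ e ∈ E₂, z ∈ e} := fun e he z hz => ⟨e, he, hz⟩
    have gS : {z : V | ∃ e ∈ E₁, z ∈ e} ∩ {z : V | ∃ e ∈ E₂, z ∈ e} ⊆ ({m} : Set V) :=
      fun z hz => hV z hz.1 hz.2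
    have gaV₂ : a ∉ {z : V | ∃ e ∈ E₂, z ∈ e} := fun ⟨e, he, hae⟩ => ha e he hae
    have gbV₁ : b ∉ {z : V | ∃ e ∈ E₁, z ∈ e} := fun ⟨e, he, hbe⟩ => hb e he hbe
    have gam : a ≠ m := by
      obtain ⟨e, he, hme⟩ := h₂.left_mem
      intro ham; exact ha e he (ham ▸ hme)
    have gbm : b ≠ m := by
      obtain ⟨e, he, hme⟩ := h₁.right_mem
      intro hbm; exact hb e he (hbm ▸ hme)
    have gab : a ≠ b := by
      obtain ⟨e, he, hae⟩ := h₁.left_mem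
      intro hab; exact hb e he (hab ▸ hae)
    have hMeq : M = M ∩ E₁ ∪ M ∩ E₂ := by
      rw [← Finset.inter_union_distrib_left, Finset.inter_eq_left.2 hM]
    have hCeq : C = C ∩ E₁ ∪ C ∩ E₂ := by
      rw [← Finset.inter_union_distrib_left, Finset.inter_eq_left.2 hC]
    rw [hMeq] at hmono ⊢
    rw [hCeq]
    exact apUpcCLW_series_nonneg hd g₁ g₂ gS gaV₂ gbV₁ gam gbm gab Finset.inter_subset_right Finset.inter_subset_right
      Finset.inter_subset_right Finset.inter_subset_right
      (ih₁ _ _ Finset.inter_subset_right Finset.inter_subset_right)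
      (ih₂ _ _ Finset.inter_subset_right Finset.inter_subset_right) hw hmono
  | @parallel E₁ E₂ s t h₁ h₂ hd hV ih₁ ih₂ =>
    intro M C hM hC w hw h hmono
    have g₁ : ∀ e ∈ (↑E₁ : Set (Sym2 V)), ∀ z ∈ e, z ∈ {z : V | ∃ e ∈ E₁, z ∈ e} := fun e he z hz => ⟨e, he, hz⟩
    have g₂ : ∀ e ∈ (↑E₂ : Set (Sym2 V)), ∀ z ∈ e, z ∈ {z : V | ∃ e ∈ E₂, z ∈ e} := fun e he z hz => ⟨e, he, hz⟩
    have gS : {z : V | ∃ e ∈ E₁, z ∈ e} ∩ {z : V | ∃ e ∈ E₂, z ∈ e} ⊆ ({s, t} : Set V) := by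
      intro z hz
      rcases hV z hz.1 hz.2 with h | h
      · exact Or.inl h
      · exact Or.inr h
    have gst : s ≠ t := h₁.ne
    have hMeq : M = M ∩ E₁ ∪ M ∩ E₂ := by
      rw [← Finset.inter_union_distrib_left, Finset.inter_eq_left.2 hM]
    have hCeq : C = C ∩ E₁ ∪ C ∩ E₂ := by
      rw [← Finset.inter_union_distrib_left, Finset.inter_eq_left.2 hC]
    rw [hMeq] at hmono ⊢
    rw [hCeq]
    exact apUpcCLW_parallel_nonneg hd g₁ g₂ gS gst Finset.inter_subset_right Finset.inter_subset_right
      Finset.inter_subset_right Finset.inter_subset_right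
      (ih₁ _ _ Finset.inter_subset_right Finset.inter_subset_right)
      (ih₂ _ _ Finset.inter_subset_right Finset.inter_subset_right) hw hmono

/-- **COROLLARY: every coefficient of `q ↦ apUpcC q M C s t h` is nonnegative** (Theorem U levelwise in every cell).
[cite: Grimmett2006, §3.8 Thm. (3.90) (pp. 61–62)] [cite: Wagner2006, Thm. 5.8(d), §5.3] -/
theorem apUpcC_level_nonneg_of_isTTSP {E : Finset (Sym2 V)} {s t : V} (hE : IsTTSP E s t) {M C : Finset (Sym2 V)}
    (hM : M ⊆ E) (hC : C ⊆ E) (ℓ : ℕ) {h : Finset (Sym2 V) → ℝ} (hmono : ∀ ⦃A B : Finset (Sym2 V)⦄, A ⊆ B → B ⊆ M → h A ≤ h B) :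
    0 ≤ ∑ γ ∈ M.powerset with apExpC M C γ = ℓ, (apConn (γ ∪ C) s t - apConn (M \ γ ∪ C) s t) * h γ := by
  have key := apUpcCLW_nonneg_of_isTTSP hE M C hM hC (fun n => if n = ℓ then 1 else 0)
    (fun n => by split_ifs <;> norm_num) h hmono
  unfold apUpcCLW at key
  rw [Finset.sum_filter]
  refine key.trans_eq (Finset.sum_congr rfl fun γ _ => ?_)
  simp only [ite_mul, one_mul, zero_mul]

/-- **COROLLARY: Abel partial sums** — `0 ≤ ∑_{γ : level ≤ J} (c(γ∪C) − c(γᶜ∪C)) h(γ)` in every cell. [cite: Grimmett2006, §3.8 Thm. (3.90) (pp. 61–62)] -/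
theorem apUpcC_levels_le_nonneg_of_isTTSP {E : Finset (Sym2 V)} {s t : V} (hE : IsTTSP E s t) {M C : Finset (Sym2 V)}
    (hM : M ⊆ E) (hC : C ⊆ E) (J : ℕ) {h : Finset (Sym2 V) → ℝ} (hmono : ∀ ⦃A B : Finset (Sym2 V)⦄, A ⊆ B → B ⊆ M → h A ≤ h B) :
    0 ≤ ∑ γ ∈ M.powerset with apExpC M C γ ≤ J, (apConn (γ ∪ C) s t - apConn (M \ γ ∪ C) s t) * h γ := by
  have key := apUpcCLW_nonneg_of_isTTSP hE M C hM hC (fun n => if n ≤ J then 1 else 0)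
    (fun n => by split_ifs <;> norm_num) h hmono
  unfold apUpcCLW at key
  rw [Finset.sum_filter]
  refine key.trans_eq (Finset.sum_congr rfl fun γ _ => ?_)
  simp only [ite_mul, one_mul, zero_mul]

end Main

/-! ### The `q`-free single-edge antipodal inequality in every cell -/

section Pivot

variable {s t : V}

/-- **The weighted pivot identity with a contracted set.**  For `x = st ∉ M`, any `C`, `g` not reading `x` and any weight `w`:
`∑_{γ ⊆ M ∪ {x}} w(k(γ∪C)+k(γᶜ∪C)) (1_x γ − 1_x γᶜ)(g(γ∪C) − g(γᶜ∪C)) = − apUpcCLW (n ↦ w(n−1) − w(n)) M C s t (γ ↦ g(γ∪C) − g((M\γ)∪C))`.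
[cite: Grimmett2006, §1.4 eq. (1.20) (p. 15); Thm. (3.1)(a)] -/
theorem apPsiCW_pivot_eq (w : ℕ → ℝ) {M : Finset (Sym2 V)} (C : Finset (Sym2 V)) (hst : s(s, t) ∉ M) {g : Finset (Sym2 V) → ℝ}
    (hg : ∀ A : Finset (Sym2 V), g (insert s(s, t) A) = g A) :
    ∑ γ ∈ (insert s(s, t) M).powerset, w (apExpC (insert s(s, t) M) C γ) *
        (((if s(s, t) ∈ γ then (1 : ℝ) else 0) - (if s(s, t) ∈ insert s(s, t) M \ γ then 1 else 0)) *
          (g (γ ∪ C) - g (insert s(s, t) M \ γ ∪ C))) =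
      - apUpcCLW (fun n => w (n - 1) - w n) M C s t (fun γ => g (γ ∪ C) - g (M \ γ ∪ C)) := by
  unfold apUpcCLW
  rw [Finset.sum_powerset_insert hst, ← Finset.sum_add_distrib, ← Finset.sum_neg_distrib]
  refine Finset.sum_congr rfl fun γ hγ => ?_
  have hγM : γ ⊆ M := Finset.mem_powerset.1 hγ
  have hxγ : s(s, t) ∉ γ := fun h => hst (hγM h)
  have hxc : s(s, t) ∉ M \ γ := fun h => hst (Finset.sdiff_subset h)
  have e1 : insert s(s, t) M \ γ = insert s(s, t) (M \ γ) := Finset.insert_sdiff_of_notMem M hxγ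
  have e2 : insert s(s, t) M \ insert s(s, t) γ = M \ γ := by
    rw [Finset.insert_sdiff_insert, Finset.sdiff_insert_of_notMem hst]
  rw [e1, e2, Finset.insert_union, Finset.insert_union]
  simp only [hxγ, hxc, Finset.mem_insert_self, if_true, if_false, hg]
  have k1 := clusterCount_union_pair_add (↑(γ ∪ C) : BondConfig V) s t
  have k2 := clusterCount_union_pair_add (↑(M \ γ ∪ C) : BondConfig V) s t
  have c1 : (↑(insert s(s, t) (γ ∪ C)) : BondConfig V) = ↑(γ ∪ C) ∪ {s(s, t)} := by
    rw [Finset.coe_insert, Set.insert_eq, Set.union_comm]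
  have c2 : (↑(insert s(s, t) (M \ γ ∪ C)) : BondConfig V) = ↑(M \ γ ∪ C) ∪ {s(s, t)} := by
    rw [Finset.coe_insert, Set.insert_eq, Set.union_comm]
  have ex1 : apExpC (insert s(s, t) M) C (insert s(s, t) γ) + 1 =
      apExpC M C γ + (if (openGraph (↑(γ ∪ C) : BondConfig V)).Reachable s t then 1 else 0) := by
    unfold apExpC
    rw [e2, Finset.insert_union, c1]
    split_ifs at k1 with hr
    · rw [if_pos hr]; omega
    · rw [if_neg hr]; omega
  have ex2 : apExpC (insert s(s, t) M) C γ + 1 =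
      apExpC M C γ + (if (openGraph (↑(M \ γ ∪ C) : BondConfig V)).Reachable s t then 1 else 0) := by
    unfold apExpC
    rw [e1, Finset.insert_union, c2]
    split_ifs at k2 with hr
    · rw [if_pos hr]; omega
    · rw [if_neg hr]; omega
  unfold apConn
  by_cases a₁ : (openGraph (↑(γ ∪ C) : BondConfig V)).Reachable s t <;>
  by_cases b₁ : (openGraph (↑(M \ γ ∪ C) : BondConfig V)).Reachable s t <;>
  simp only [a₁, b₁, if_true, if_false] at ex1 ex2 ⊢
  · have h1 : apExpC (insert s(s, t) M) C (insert s(s, t) γ) = apExpC M C γ := by omega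
    have h2 : apExpC (insert s(s, t) M) C γ = apExpC M C γ := by omega
    rw [h1, h2]; ring
  · have h1 : apExpC (insert s(s, t) M) C (insert s(s, t) γ) = apExpC (insert s(s, t) M) C γ + 1 := by omega
    have h2 : apExpC M C γ = apExpC (insert s(s, t) M) C γ + 1 := by omega
    rw [h1, h2, Nat.add_sub_cancel]; ring
  · have h1 : apExpC (insert s(s, t) M) C γ = apExpC (insert s(s, t) M) C (insert s(s, t) γ) + 1 := by omega
    have h2 : apExpC M C γ = apExpC (insert s(s, t) M) C (insert s(s, t) γ) + 1 := by omega
    rw [h1, h2, Nat.add_sub_cancel]; ring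
  · have h1 : apExpC (insert s(s, t) M) C (insert s(s, t) γ) = apExpC (insert s(s, t) M) C γ := by omega
    rw [h1]; ring

/-- **`q`-free single-edge inequality, rooted, in every cell.**  `E` TTSP between `s, t`, `x = st ∉ E`, `M, C ⊆ E`, `w` antitone, `g`
monotone on the subsets of `M ∪ C` and not reading `x` ⟹ the weighted antipodal form of `1_x` against `g` over the cell `(M ∪ {x}, C)`
is `≤ 0`. [cite: Grimmett2006, §3.8 Thm. (3.90) (pp. 61–62); §3.9 (pp. 63–64)] [cite: Wagner2006, Thm. 5.8(d), §5.3] -/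
theorem apPsiCW_pivot_nonpos_of_isTTSP {E M C : Finset (Sym2 V)} (hE : IsTTSP E s t) (hM : M ⊆ E) (hC : C ⊆ E)
    (hst : s(s, t) ∉ E) {w : ℕ → ℝ} (hw : ∀ n : ℕ, w (n + 1) ≤ w n) {g : Finset (Sym2 V) → ℝ}
    (hg : ∀ A : Finset (Sym2 V), g (insert s(s, t) A) = g A)
    (hmono : ∀ ⦃A B : Finset (Sym2 V)⦄, A ⊆ B → B ⊆ M ∪ C → g A ≤ g B) :
    ∑ γ ∈ (insert s(s, t) M).powerset, w (apExpC (insert s(s, t) M) C γ) *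
        (((if s(s, t) ∈ γ then (1 : ℝ) else 0) - (if s(s, t) ∈ insert s(s, t) M \ γ then 1 else 0)) *
          (g (γ ∪ C) - g (insert s(s, t) M \ γ ∪ C))) ≤ 0 := by
  rw [apPsiCW_pivot_eq w C (fun h => hst (hM h)) hg, neg_nonpos]
  refine apUpcCLW_nonneg_of_isTTSP hE M C hM hC (fun n => w (n - 1) - w n) (fun n => ?_)
    (fun γ => g (γ ∪ C) - g (M \ γ ∪ C)) ?_
  · cases n with
    | zero => simp
    | succ k => rw [Nat.add_sub_cancel]; linarith [hw k]
  · intro A B hAB hBM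
    have h1 := hmono (Finset.union_subset_union hAB le_rfl) (Finset.union_subset_union hBM le_rfl)
    have h2 := hmono (Finset.union_subset_union (Finset.sdiff_subset_sdiff (le_refl M) hAB) le_rfl)
      (Finset.union_subset_union Finset.sdiff_subset (le_refl C))
    linarith

/-- **`q`-free single-edge inequality at any pivot of any cell.**  `E` TTSP between `s, t`, `st ∉ E`, `H = E ∪ {st}`; `M, C ⊆ H` disjoint
(live / contracted); `a ∈ M`; `w` antitone; `g` increasing on the subsets of `M`, reading neither `a` nor the edges of `C` ⟹
`∑_{γ ⊆ M} w(k(γ∪C)+k((M\γ)∪C)) (1_a γ − 1_a γᶜ)(g(γ∪C) − g((M\γ)∪C)) ≤ 0`.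
[cite: Grimmett2006, §3.8 Thm. (3.90) (pp. 61–62); §3.9 (pp. 63–64)] [cite: Wagner2006, Thm. 5.8(d), §5.3] -/
theorem apPsiCW_pivot_sub_nonpos_of_isTTSP {E : Finset (Sym2 V)} (hE : IsTTSP E s t) (hst : s(s, t) ∉ E) {M C : Finset (Sym2 V)}
    (hM : M ⊆ insert s(s, t) E) (hC : C ⊆ insert s(s, t) E) (hMC : Disjoint M C) {a : Sym2 V} (ha : a ∈ M)
    {w : ℕ → ℝ} (hw : ∀ n : ℕ, w (n + 1) ≤ w n) {g : Finset (Sym2 V) → ℝ}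
    (hga : ∀ A : Finset (Sym2 V), g (insert a A) = g A) (hgC : ∀ e ∈ C, ∀ A : Finset (Sym2 V), g (insert e A) = g A)
    (hmono : ∀ ⦃A B : Finset (Sym2 V)⦄, A ⊆ B → B ⊆ M → g A ≤ g B) :
    ∑ γ ∈ M.powerset, w (apExpC M C γ) *
        (((if a ∈ γ then (1 : ℝ) else 0) - (if a ∈ M \ γ then 1 else 0)) * (g (γ ∪ C) - g (M \ γ ∪ C))) ≤ 0 := by
  induction a using Sym2.ind with
  | h a₁ a₂ =>
    have hR := hE.reroot_erase (hM ha) (insert_ne_singleton_of_isTTSP hE hst _)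
    have haC : s(a₁, a₂) ∉ C := fun h => Finset.disjoint_left.1 hMC ha h
    have hMa : M.erase s(a₁, a₂) ⊆ (insert s(s, t) E).erase s(a₁, a₂) := Finset.erase_subset_erase _ hM
    have hCa : C ⊆ (insert s(s, t) E).erase s(a₁, a₂) := fun e he => Finset.mem_erase.2 ⟨fun h => haC (h ▸ he), hC he⟩
    have key := apPsiCW_pivot_nonpos_of_isTTSP hR hMa hCa (Finset.notMem_erase _ _) hw hga
      (fun A B hAB hB => by
        rw [eq_sdiff_of_notRead hgC A, eq_sdiff_of_notRead hgC B]
        refine hmono (Finset.sdiff_subset_sdiff hAB le_rfl) fun e he => ?_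
        have he' := Finset.mem_sdiff.1 he
        rcases Finset.mem_union.1 (hB he'.1) with h | h
        · exact Finset.mem_of_mem_erase h
        · exact absurd h he'.2)
    rw [Finset.insert_erase ha] at key
    exact key

/-- **Partial sums** — for every level cut-off `J`, in every cell:
`∑_{γ ⊆ M : k(γ∪C)+k((M\γ)∪C) ≤ J} (1_a γ − 1_a γᶜ)(g(γ∪C) − g((M\γ)∪C)) ≤ 0`; summed against `q^J(1−q) ≥ 0` this is `apPsiC q M C 1_a g ≤ 0`
(gen 11), and it says that `Z_H² Cov_{φ_{z,q}}(ω_a, g) / (q − 1)` — in particular the Rayleigh difference `ΔZ_H{a,b} / (1 − q)` — has only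
nonnegative coefficients in `(z, q)`. [cite: Grimmett2006, §3.8 Thm. (3.90) (pp. 61–62); §3.9 (pp. 63–64)] [cite: Wagner2006, Thm. 5.8(d), §5.3] -/
theorem apPsiC_levels_le_pivot_nonpos_of_isTTSP {E : Finset (Sym2 V)} (hE : IsTTSP E s t) (hst : s(s, t) ∉ E) {M C : Finset (Sym2 V)}
    (hM : M ⊆ insert s(s, t) E) (hC : C ⊆ insert s(s, t) E) (hMC : Disjoint M C) {a : Sym2 V} (ha : a ∈ M) (J : ℕ)
    {g : Finset (Sym2 V) → ℝ} (hga : ∀ A : Finset (Sym2 V), g (insert a A) = g A)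
    (hgC : ∀ e ∈ C, ∀ A : Finset (Sym2 V), g (insert e A) = g A)
    (hmono : ∀ ⦃A B : Finset (Sym2 V)⦄, A ⊆ B → B ⊆ M → g A ≤ g B) :
    ∑ γ ∈ M.powerset with apExpC M C γ ≤ J,
        ((if a ∈ γ then (1 : ℝ) else 0) - (if a ∈ M \ γ then 1 else 0)) * (g (γ ∪ C) - g (M \ γ ∪ C)) ≤ 0 := by
  have key := apPsiCW_pivot_sub_nonpos_of_isTTSP hE hst hM hC hMC ha (w := fun n => if n ≤ J then (1 : ℝ) else 0)
    (fun n => by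
      split_ifs with h1 h2 h2
      · exact le_rfl
      · exact absurd ((Nat.le_succ n).trans h1) h2
      · exact zero_le_one
      · exact le_rfl) hga hgC hmono
  rw [Finset.sum_filter]
  refine le_of_eq_of_le (Finset.sum_congr rfl fun γ _ => ?_) key
  split_ifs <;> ring

/-- **THE RAYLEIGH DIFFERENCE OF A SERIES–PARALLEL GRAPH LIES IN `(1 − q)·ℝ≥0[z, q]`.**  `E` TTSP between `s, t`, `st ∉ E`, `H = E ∪ {st}`
(every 2-connected series–parallel graph, presented from an edge); `M, C ⊆ H` disjoint; `a ≠ b ∈ M`.  Then for every level cut-off `J`: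
`∑_{γ ⊆ M : k(γ∪C)+k((M\γ)∪C) ≤ J} (1_a γ − 1_a γᶜ)(1_b γ − 1_b γᶜ) ≤ 0`.  Dictionary (FK-Q2 §20, §30): `Z_H(z,q)² Cov_{φ_{z,q}}(ω_a, ω_b) = −z_a z_b ΔZ_H{a,b}`
with the Rayleigh difference `ΔZ_H{a,b} = Z^{a}_{b} Z^{b}_{a} − Z_{ab} Z^{ab}`, and the coefficient of `z^{2·1_C + 1_M} q^ℓ` in `Z_H² Cov(ω_a, ω_b)` is
`½ ∑_{γ ⊆ M : level = ℓ} (1_a γ − 1_a γᶜ)(1_b γ − 1_b γᶜ)`; so the displayed partial sums are (minus) the coefficients of `ΔZ_H{a,b}(z,q)/(1−q)`, all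
`≥ 0`: Wagner's Rayleigh monotonicity of series–parallel graphs (`ΔZ ≥ 0` for `z ≥ 0`, `0 < q ≤ 1`; Wagner 2008, Semple–Welsh 2008 §4) holds
COEFFICIENTWISE in `(z, q)` after division by `1 − q`.  False for `K₄` (complementary Hamilton paths, FK-Q2 §19.6/§30).
[cite: Grimmett2006, §3.8 Thm. (3.90) (pp. 61–62); §3.9 (pp. 63–64)] [cite: Wagner2006, Thm. 5.8(d), §5.3] -/
theorem apPsiC_levels_le_two_pivots_nonpos_of_isTTSP {E : Finset (Sym2 V)} (hE : IsTTSP E s t) (hst : s(s, t) ∉ E)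
    {M C : Finset (Sym2 V)} (hM : M ⊆ insert s(s, t) E) (hC : C ⊆ insert s(s, t) E) (hMC : Disjoint M C) {a b : Sym2 V}
    (ha : a ∈ M) (hb : b ∈ M) (hab : a ≠ b) (J : ℕ) :
    ∑ γ ∈ M.powerset with apExpC M C γ ≤ J,
        ((if a ∈ γ then (1 : ℝ) else 0) - (if a ∈ M \ γ then 1 else 0)) *
          ((if b ∈ γ ∪ C then (1 : ℝ) else 0) - (if b ∈ M \ γ ∪ C then 1 else 0)) ≤ 0 := by
  have hbC : b ∉ C := fun h => Finset.disjoint_left.1 hMC hb h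
  refine apPsiC_levels_le_pivot_nonpos_of_isTTSP hE hst hM hC hMC ha J (g := fun A => if b ∈ A then (1 : ℝ) else 0)
    (fun A => by simp only [Finset.mem_insert, hab.symm, false_or]) (fun e he A => ?_) (fun A B hAB _ => ?_)
  · have hbe : b ≠ e := fun h => hbC (h ▸ he)
    simp only [Finset.mem_insert, hbe, false_or]
  · by_cases h : b ∈ A
    · rw [if_pos h, if_pos (hAB h)]
    · rw [if_neg h]; split_ifs <;> norm_num

end Pivot

/-! ### Level 2 in every cell -/

section Level2

variable {s t : V}

/-- **`q`-free level 2 in every cell.**  `E` TTSP between `s, t`, `st ∉ E`, `M, C ⊆ E ∪ {st}` disjoint, `a, b ∈ M`, `w` antitone, `f`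
increasing on the subsets of `{a, b}` reading no other edge, `g` increasing on the subsets of `M` reading neither `a, b` nor the edges of `C` ⟹
`∑_{γ ⊆ M} w(k(γ∪C)+k((M\γ)∪C)) (f(γ∪C) − f((M\γ)∪C))(g(γ∪C) − g((M\γ)∪C)) ≤ 0`.
[cite: Grimmett2006, §3.8 Thm. (3.90) (pp. 61–62); §3.9 (pp. 63–64)] [cite: Wagner2006, Thm. 5.8(d), §5.3] -/
theorem apPsiCW_level2_nonpos_of_isTTSP {E : Finset (Sym2 V)} (hE : IsTTSP E s t) (hst : s(s, t) ∉ E) {M C : Finset (Sym2 V)}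
    (hM : M ⊆ insert s(s, t) E) (hC : C ⊆ insert s(s, t) E) (hMC : Disjoint M C) {a b : Sym2 V} (ha : a ∈ M) (hb : b ∈ M)
    {w : ℕ → ℝ} (hw : ∀ n : ℕ, w (n + 1) ≤ w n) {f g : Finset (Sym2 V) → ℝ}
    (hf : ∀ e : Sym2 V, e ∉ ({a, b} : Finset (Sym2 V)) → ∀ A : Finset (Sym2 V), f (insert e A) = f A)
    (hfmono : ∀ ⦃A B : Finset (Sym2 V)⦄, A ⊆ B → B ⊆ ({a, b} : Finset (Sym2 V)) → f A ≤ f B)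
    (hga : ∀ A : Finset (Sym2 V), g (insert a A) = g A) (hgb : ∀ A : Finset (Sym2 V), g (insert b A) = g A)
    (hgC : ∀ e ∈ C, ∀ A : Finset (Sym2 V), g (insert e A) = g A)
    (hmono : ∀ ⦃A B : Finset (Sym2 V)⦄, A ⊆ B → B ⊆ M → g A ≤ g B) :
    ∑ γ ∈ M.powerset, w (apExpC M C γ) * ((f (γ ∪ C) - f (M \ γ ∪ C)) * (g (γ ∪ C) - g (M \ γ ∪ C))) ≤ 0 := by
  have haC : a ∉ C := fun h => Finset.disjoint_left.1 hMC ha h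
  have hbC : b ∉ C := fun h => Finset.disjoint_left.1 hMC hb h
  have hfC : ∀ e ∈ C, ∀ A : Finset (Sym2 V), f (insert e A) = f A := fun e he A =>
    hf e (by
      simp only [Finset.mem_insert, Finset.mem_singleton, not_or]
      exact ⟨fun h => haC (h ▸ he), fun h => hbC (h ▸ he)⟩) A
  have hfU : ∀ A : Finset (Sym2 V), f (A ∪ C) = f A := fun A => notRead_union hfC C le_rfl A
  have sub : ∀ A : Finset (Sym2 V), (∀ e ∈ A, e = a ∨ e = b) → A ⊆ ({a, b} : Finset (Sym2 V)) := fun A hA e he => by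
    simp only [Finset.mem_insert, Finset.mem_singleton]; exact hA e he
  have m1 : f ∅ ≤ f {a} := hfmono (Finset.empty_subset _) (sub _ (by simp))
  have m2 : f ∅ ≤ f {b} := hfmono (Finset.empty_subset _) (sub _ (by simp))
  have m3 : f {a} ≤ f {a, b} := hfmono (by intro e; simp only [Finset.mem_insert, Finset.mem_singleton]; tauto) (sub _ (by simp))
  have m4 : f {b} ≤ f {a, b} := hfmono (by intro e; simp only [Finset.mem_insert, Finset.mem_singleton]; tauto) (sub _ (by simp))
  have hα : 0 ≤ (f {a, b} - f ∅ + f {a} - f {b}) / 2 := by linarith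
  have hβ : 0 ≤ (f {a, b} - f ∅ - f {a} + f {b}) / 2 := by linarith
  have Ua := apPsiCW_pivot_sub_nonpos_of_isTTSP hE hst hM hC hMC ha hw hga hgC hmono
  have Ub := apPsiCW_pivot_sub_nonpos_of_isTTSP hE hst hM hC hMC hb hw hgb hgC hmono
  have split : ∑ γ ∈ M.powerset, w (apExpC M C γ) * ((f (γ ∪ C) - f (M \ γ ∪ C)) * (g (γ ∪ C) - g (M \ γ ∪ C))) =
      (f {a, b} - f ∅ + f {a} - f {b}) / 2 *
          ∑ γ ∈ M.powerset, w (apExpC M C γ) *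
            (((if a ∈ γ then (1 : ℝ) else 0) - (if a ∈ M \ γ then 1 else 0)) * (g (γ ∪ C) - g (M \ γ ∪ C))) +
        (f {a, b} - f ∅ - f {a} + f {b}) / 2 *
          ∑ γ ∈ M.powerset, w (apExpC M C γ) *
            (((if b ∈ γ then (1 : ℝ) else 0) - (if b ∈ M \ γ then 1 else 0)) * (g (γ ∪ C) - g (M \ γ ∪ C))) := by
    rw [Finset.mul_sum, Finset.mul_sum, ← Finset.sum_add_distrib]
    refine Finset.sum_congr rfl fun γ _ => ?_
    rw [hfU γ, hfU (M \ γ), odd_level2_eq ha hb hf γ]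
    ring
  rw [split]
  nlinarith

/-- **`q`-free level 2 in every cell, partial sums**: for every level cut-off `J`,
`∑_{γ ⊆ M : k(γ∪C)+k((M\γ)∪C) ≤ J} (f(γ∪C) − f((M\γ)∪C))(g(γ∪C) − g((M\γ)∪C)) ≤ 0` — every coefficient, in the edge odds AND in `q`, of
`Z_H² Cov_{φ_{z,q}}(f, g) / (q − 1)` is nonnegative when `f` is an increasing function of two edges of a series–parallel graph `H`.
[cite: Grimmett2006, §3.8 Thm. (3.90) (pp. 61–62); §3.9 (pp. 63–64)] [cite: Wagner2006, Thm. 5.8(d), §5.3] -/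
theorem apPsiC_levels_le_level2_nonpos_of_isTTSP {E : Finset (Sym2 V)} (hE : IsTTSP E s t) (hst : s(s, t) ∉ E)
    {M C : Finset (Sym2 V)} (hM : M ⊆ insert s(s, t) E) (hC : C ⊆ insert s(s, t) E) (hMC : Disjoint M C) {a b : Sym2 V}
    (ha : a ∈ M) (hb : b ∈ M) (J : ℕ) {f g : Finset (Sym2 V) → ℝ}
    (hf : ∀ e : Sym2 V, e ∉ ({a, b} : Finset (Sym2 V)) → ∀ A : Finset (Sym2 V), f (insert e A) = f A)
    (hfmono : ∀ ⦃A B : Finset (Sym2 V)⦄, A ⊆ B → B ⊆ ({a, b} : Finset (Sym2 V)) → f A ≤ f B)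
    (hga : ∀ A : Finset (Sym2 V), g (insert a A) = g A) (hgb : ∀ A : Finset (Sym2 V), g (insert b A) = g A)
    (hgC : ∀ e ∈ C, ∀ A : Finset (Sym2 V), g (insert e A) = g A)
    (hmono : ∀ ⦃A B : Finset (Sym2 V)⦄, A ⊆ B → B ⊆ M → g A ≤ g B) :
    ∑ γ ∈ M.powerset with apExpC M C γ ≤ J, (f (γ ∪ C) - f (M \ γ ∪ C)) * (g (γ ∪ C) - g (M \ γ ∪ C)) ≤ 0 := by
  have key := apPsiCW_level2_nonpos_of_isTTSP hE hst hM hC hMC ha hb (w := fun n => if n ≤ J then (1 : ℝ) else 0)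
    (fun n => by
      split_ifs with h1 h2 h2
      · exact le_rfl
      · exact absurd ((Nat.le_succ n).trans h1) h2
      · exact zero_le_one
      · exact le_rfl) hf hfmono hga hgb hgC hmono
  rw [Finset.sum_filter]
  refine le_of_eq_of_le (Finset.sum_congr rfl fun γ _ => ?_) key
  split_ifs <;> ring

end Level2

end FK

end Summit.CriticalPhenomena.PercolationContinuityZ3.Theorems

end
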